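import Literature.MathematicalPhysics.KineticTheory.ZeroWavenumberDataOfClustering
import Literature.MathematicalPhysics.KineticTheory.ZeroWavenumberSpace
import Literature.MathematicalPhysics.KineticTheory.TransportRegularityOfMixing
import Literature.MathematicalPhysics.KineticTheory.InfiniteChainTwoPointContinuity
import Literature.MathematicalPhysics.KineticTheory.InfiniteChainCorrelationContinuity
import Literature.MathematicalPhysics.KineticTheory.InfiniteChainCurrentMoments
import Literature.MathematicalPhysics.KineticTheory.InfiniteChainCurrentPositiveType
import Literature.MathematicalPhysics.KineticTheory.InfiniteChainEnergyDensityMoments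
import Literature.MathematicalPhysics.KineticTheory.InfiniteChainPartialMomentumReversal
import Literature.MathematicalPhysics.KineticTheory.InfiniteChainGibbsInvariance
import Literature.MathematicalPhysics.KineticTheory.InfiniteChainShiftInvariantUniqueness
import Literature.MathematicalPhysics.KineticTheory.InfiniteChainGoodSetSymmetries
import Literature.MathematicalPhysics.KineticTheory.InfiniteChainGibbsMomenta
import HarnessLib

/-!
# Stub `stub_pulseCurrentAsCovariance` of line `Sketch` (crux `CoercivePulse.PulseCalculus`,
stmt-AtomisticToContinuum-15385)

For the pinned anharmonic chain (`ω₂, lam, β > 0`) in a shift-invariant DLR state `μ` at `T > 0` and the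
canonical Buttà–Marchioro dynamics `D` (carrier `bmGood`, measurable flow maps, identity off `bmGood`):
the equilibrium energy pulse `S(x,t) = ∫ (h_0 − ⟨h_0⟩)(h_x ∘ φ_t − ⟨h_0⟩) dμ` (with `h` the split-bond site
energy `energyDensityZ`) and the current pair correlations `G(x,t) = ∫ j_0 (j_x ∘ φ_t) dμ` of the
Green–Kubo integrand are the translated two-time covariances `Cov_μ(h_0, (h_0 ∘ φ_t) ∘ τ_x)`,
`Cov_μ(j_0, (j_0 ∘ φ_t) ∘ τ_x)`, and each `S(x,·)`, `G(x,·)` is continuous in time.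

How: every shift-invariant DLR state is superstable (`hasSuperstabilityEstimate_of_isShiftInvariant_pinnedChain`),
so `D` preserves `μ` (`preservesMeasure_of_carrier_eq_bmGood`); the flow commutes with every lattice shift
everywhere (`flow_chainShift_of_eq_id`), `h_0 ∘ τ_x = h_x`, `j_0 ∘ τ_x = j_x`
(`energyDensityZ_chainShift`, `bondCurrentZ_chainShift`); the mean of `h_0` is invariant under `τ_x` and
`φ_t`, the mean current vanishes (`IsChainGibbsMeasure.integral_bondCurrentZ_eq_zero`) and
`Cov = ∫XY − ∫X∫Y` in `L²` (`covariance_eq_sub`); continuity is the two-point continuity along orbits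
(`continuous_integral_energyDensityZ_mul_flow_pinnedChain`, `continuous_integral_bondCurrentZ_mul_flow_pinnedChain`).
A re-export of steps §6 and §9 of `Theorems/HoelderEscapeProfileFibreCalculus.lean`.
[cite: BonettoLebowitzReyBellet2000, §7 eq. (37)]
-/

noncomputable section

namespace Summit.AtomisticToContinuum.FouriersLaw.Theorems.PulseCalculus.CanonicalReduction

open MeasureTheory ProbabilityTheory Filter Topology Set Function
open Literature.MathematicalPhysics.KineticTheory.HeatConduction

/-- **S2 `stub_pulseCurrentAsCovariance`.** For the pinned chain (`ω₂, lam, β > 0`), a shift-invariant DLR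
state `μ` at `T > 0` and a dynamics `D` with carrier `bmGood`, measurable flow maps and `D.flow t = id` off
`bmGood`; `h` the split-bond site energy, `S` the pulse, `G` the current pair correlations:
`S(x,t) = Cov_μ(h_0, (h_0 ∘ φ_t) ∘ τ_x)`, `G(x,t) = Cov_μ(j_0, (j_0 ∘ φ_t) ∘ τ_x)`, and each `S(x,·)`,
`G(x,·)` is continuous. [cite: BonettoLebowitzReyBellet2000, §7 eq. (37)] -/
theorem stub_pulseCurrentAsCovariance :
    ∀ ω₂ lam β γ : ℝ, 0 < ω₂ → 0 < lam → 0 < β → ∀ T : ℝ, 0 < T →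
    ∀ μ : Measure ChainConfig, (pinnedChain ω₂ lam β γ).IsChainGibbsMeasure T μ → IsShiftInvariant μ →
    ∀ D : InfiniteChainDynamics (pinnedChain ω₂ lam β γ),
    D.carrier = (pinnedChain ω₂ lam β γ).bmGood → (∀ t : ℝ, Measurable (D.flow t)) →
    (∀ t : ℝ, ∀ σ ∉ (pinnedChain ω₂ lam β γ).bmGood, D.flow t σ = σ) →
    ∀ h : ChainConfig → ℤ → ℝ,
      h = (fun (σ : ChainConfig) (x : ℤ) => (σ x).2 ^ 2 / 2 + (pinnedChain ω₂ lam β γ).U (σ x).1 +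
        ((pinnedChain ω₂ lam β γ).V ((σ (x + 1)).1 - (σ x).1) +
          (pinnedChain ω₂ lam β γ).V ((σ x).1 - (σ (x - 1)).1)) / 2) →
    ∀ S : ℤ → ℝ → ℝ,
      S = (fun (x : ℤ) (t : ℝ) =>
        ∫ σ, (h σ 0 - ∫ σ', h σ' 0 ∂μ) * (h (D.flow t σ) x - ∫ σ', h σ' 0 ∂μ) ∂μ) →
    ∀ G : ℤ → ℝ → ℝ,
      G = (fun (x : ℤ) (t : ℝ) => ∫ σ, (pinnedChain ω₂ lam β γ).bondCurrentZ σ 0 *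
        (pinnedChain ω₂ lam β γ).bondCurrentZ (D.flow t σ) x ∂μ) →
    (∀ (x : ℤ) (t : ℝ), S x t = cov[fun σ => (pinnedChain ω₂ lam β γ).energyDensityZ σ 0,
        ((fun σ => (pinnedChain ω₂ lam β γ).energyDensityZ σ 0) ∘ D.flow t) ∘ chainShift x; μ]) ∧
    (∀ (x : ℤ) (t : ℝ), G x t = cov[fun σ => (pinnedChain ω₂ lam β γ).bondCurrentZ σ 0,
        ((fun σ => (pinnedChain ω₂ lam β γ).bondCurrentZ σ 0) ∘ D.flow t) ∘ chainShift x; μ]) ∧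
    (∀ x : ℤ, Continuous (S x)) ∧ (∀ x : ℤ, Continuous (G x)) := by
  intro ω₂ lam β γ hω hl hβ T hT μ hG hSI D hcar hmeas hid h hh S hS G hGd
  /- chain data, superstability, invariance of `μ` under the flow and the shifts, homogeneity everywhere -/
  have hss : (pinnedChain ω₂ lam β γ).HasSuperstabilityEstimate μ :=
    OscillatorChain.hasSuperstabilityEstimate_of_isShiftInvariant_pinnedChain γ hω hl.le hβ.le hT hG hSI
  haveI : IsProbabilityMeasure μ := hss.1
  have hU0 : ∀ q : ℝ, 0 ≤ (pinnedChain ω₂ lam β γ).U q := OscillatorChain.pinnedChain_U_nonneg β γ hω.le hl.le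
  have hV0 : ∀ r : ℝ, 0 ≤ (pinnedChain ω₂ lam β γ).V r := OscillatorChain.pinnedChain_V_nonneg ω₂ lam γ hβ.le
  have hUm : Measurable (pinnedChain ω₂ lam β γ).U := OscillatorChain.measurable_pinnedChain_U ω₂ lam β γ
  have hVm : Measurable (pinnedChain ω₂ lam β γ).V := OscillatorChain.measurable_pinnedChain_V ω₂ lam β γ
  have hU2 : OscillatorChain.IsEvenPolyOfDegree (pinnedChain ω₂ lam β γ).U 2 :=
    OscillatorChain.pinnedChain_isEvenPolyOfDegree_U β γ hω.le hl
  have hV2 : OscillatorChain.IsEvenPolyOfDegree (pinnedChain ω₂ lam β γ).V 2 :=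
    OscillatorChain.pinnedChain_isEvenPolyOfDegree_V ω₂ lam γ hβ
  have hP' : D.PreservesMeasure μ :=
    OscillatorChain.preservesMeasure_of_carrier_eq_bmGood one_le_two one_le_two hU2 hV2 D hcar hmeas hG hss
  have hφ : ∀ (t : ℝ) (x : ℤ) (σ : ChainConfig), D.flow t (chainShift x σ) = chainShift x (D.flow t σ) :=
    fun t x σ => D.flow_chainShift_of_eq_id hcar hid hU0 hV0 t x σ
  have hτ : ∀ x : ℤ, MeasurePreserving (chainShift x) μ μ := hSI.measurePreserving_chainShift
  have hh' : ∀ (σ : ChainConfig) (x : ℤ), h σ x = (pinnedChain ω₂ lam β γ).energyDensityZ σ x := by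
    intro σ x; subst hh; rfl
  /- the two generators `h₀`, `j₀` -/
  set h0 : ChainConfig → ℝ := fun σ => (pinnedChain ω₂ lam β γ).energyDensityZ σ 0 with h0def
  set j0 : ChainConfig → ℝ := fun σ => (pinnedChain ω₂ lam β γ).bondCurrentZ σ 0 with j0def
  have h0m : Measurable h0 := (pinnedChain ω₂ lam β γ).measurable_energyDensityZ hUm hVm 0
  have h02 : MemLp h0 2 μ := hss.memLp_energyDensityZ hU0 hV0 hUm hVm 0 ENNReal.ofNat_ne_top
  have j02 : MemLp j0 2 μ := hss.memLp_bondCurrentZ one_le_two hU0 hUm hV2 0 ENNReal.ofNat_ne_top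
  /- `S`, `G` as translated covariances -/
  have hmeanH : ∀ (t : ℝ) (x : ℤ), ∫ σ, ((h0 ∘ D.flow t) ∘ chainShift x) σ ∂μ = ∫ σ, h0 σ ∂μ := by
    intro t x
    have e1 : ∫ σ, ((h0 ∘ D.flow t) ∘ chainShift x) σ ∂μ = ∫ σ, (h0 ∘ D.flow t) σ ∂μ :=
      integral_comp_eq_of_measurePreserving (hτ x) (h0m.comp (hmeas t))
    rw [e1]
    exact integral_comp_eq_of_measurePreserving (hP'.2 t) h0m
  have hScov : ∀ (x : ℤ) (t : ℝ), S x t = cov[h0, (h0 ∘ D.flow t) ∘ chainShift x; μ] := by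
    intro x t
    rw [hS]
    simp only [covariance, hmeanH t x]
    refine integral_congr_ae (Eventually.of_forall fun σ => ?_)
    simp only [comp_apply, hφ t x σ, h0def, hh', OscillatorChain.energyDensityZ_chainShift, zero_add]
  have hmeanJ : ∫ σ, j0 σ ∂μ = 0 := hG.integral_bondCurrentZ_eq_zero 0
  have hGcov : ∀ (x : ℤ) (t : ℝ), G x t = cov[j0, (j0 ∘ D.flow t) ∘ chainShift x; μ] := by
    intro x t
    have hY2 : MemLp ((j0 ∘ D.flow t) ∘ chainShift x) 2 μ :=
      (j02.comp_measurePreserving (hP'.2 t)).comp_measurePreserving (hτ x)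
    rw [covariance_eq_sub j02 hY2, hmeanJ, zero_mul, sub_zero, hGd]
    refine integral_congr_ae (Eventually.of_forall fun σ => ?_)
    simp only [Pi.mul_apply, comp_apply, hφ t x σ, j0def, OscillatorChain.bondCurrentZ_chainShift, zero_add]
  /- continuity in time -/
  have hScont : ∀ x : ℤ, Continuous (S x) := by
    intro x
    have hc := InfiniteChainDynamics.continuous_integral_energyDensityZ_mul_flow_pinnedChain γ hω.le hl.le hβ
      hss D hP' x 0
    have e : S x = fun t : ℝ => (∫ σ, (pinnedChain ω₂ lam β γ).energyDensityZ σ 0 *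
        (pinnedChain ω₂ lam β γ).energyDensityZ (D.flow t σ) x ∂μ) - (∫ σ, h0 σ ∂μ) * ∫ σ, h0 σ ∂μ := by
      funext t
      have hY2 : MemLp ((h0 ∘ D.flow t) ∘ chainShift x) 2 μ :=
        (h02.comp_measurePreserving (hP'.2 t)).comp_measurePreserving (hτ x)
      rw [hScov x t, covariance_eq_sub h02 hY2, hmeanH t x]
      congr 1
      refine integral_congr_ae (Eventually.of_forall fun σ => ?_)
      simp only [Pi.mul_apply, comp_apply, hφ t x σ, h0def, OscillatorChain.energyDensityZ_chainShift, zero_add]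
    rw [e]
    exact hc.sub continuous_const
  have hGcont : ∀ x : ℤ, Continuous (G x) := by
    intro x
    rw [hGd]
    exact InfiniteChainDynamics.continuous_integral_bondCurrentZ_mul_flow_pinnedChain γ hω.le hl.le hβ hss D hP' x 0
  exact ⟨hScov, hGcov, hScont, hGcont⟩

end Summit.AtomisticToContinuum.FouriersLaw.Theorems.PulseCalculus.CanonicalReduction

end
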